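import Summits.QuantumAdvantage.QuantumAdvantage.Theorems.OrderDialAB

/-! # OrderDialA — part 3/3 (mechanical split for landing of `OrderDialA`; content verbatim; scopes re-opened with their variables) -/

set_option linter.dupNamespace false
open Finset
open Literature.Computability.MetaComplexity Literature.Computability.MetaComplexity.Smolensky
open Summit.QuantumAdvantage.AdviceFreeQNC0

namespace Summit.QuantumAdvantage.QuantumAdvantage.Theorems.OrderDial
variable {p : ℕ} [Fact p.Prime]

section NullPair
variable {n : ℕ}

/-- where `z` wins, `y` and `y ⊕ z` differ: the wins of `z` are covered by the losses of `y` and of `y ⊕ z`. -/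
theorem wins_le_losses_add {m : ℕ} (c : ℕ) (y z : Fin (m + 1) → (Fin m → Bool) → Bool) :
    wins c z ≤ (2 ^ m - wins c y) + (2 ^ m - wins c (RigidityLaws.xorStrat y z)) := by
  have hy := wins_add_losses c y
  have hyz := wins_add_losses c (RigidityLaws.xorStrat y z)
  have hsub : (univ.filter fun u : Fin m → Bool => ringWinU c z u = true) ⊆
      (univ.filter fun u : Fin m → Bool => ringWinU c y u = false) ∪
        (univ.filter fun u : Fin m → Bool => ringWinU c (RigidityLaws.xorStrat y z) u = false) := by
    intro u hu
    simp only [Finset.mem_filter, Finset.mem_univ, true_and, Finset.mem_union] at hu ⊢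
    rw [RigidityLaws.ringWinU_xorStrat, hu]
    cases ringWinU c y u <;> simp
  have h := (Finset.card_le_card hsub).trans (Finset.card_union_le _ _)
  unfold wins at hy hyz ⊢
  omega

/-- ℝ → ℕ: T's bound `#wins ≤ (1 − n^(−k))·2ⁿ` in integers. -/
theorem nat_of_real_bound {m k w : ℕ} (hm : 1 ≤ m)
    (hw : (w : ℝ) ≤ (1 - 1 / (m : ℝ) ^ k) * (2 : ℝ) ^ m) : m ^ k * w + 2 ^ m ≤ m ^ k * 2 ^ m := by
  have hK : (0 : ℝ) < (m : ℝ) ^ k := by positivity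
  have hK0 : (m : ℝ) ^ k ≠ 0 := hK.ne'
  have e : (1 - 1 / (m : ℝ) ^ k) * (2 : ℝ) ^ m * (m : ℝ) ^ k = ((m : ℝ) ^ k - 1) * (2 : ℝ) ^ m := by
    field_simp
  have h1 : (w : ℝ) * (m : ℝ) ^ k ≤ ((m : ℝ) ^ k - 1) * (2 : ℝ) ^ m := by
    rw [← e]; exact mul_le_mul_of_nonneg_right hw hK.le
  have h2 : ((m ^ k * w + 2 ^ m : ℕ) : ℝ) ≤ ((m ^ k * 2 ^ m : ℕ) : ℝ) := by
    push_cast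
    nlinarith [h1]
  exact_mod_cast h2

/-- ℕ → ℝ: the converse reading. -/
theorem real_bound_of_nat {m k w : ℕ} (hm : 1 ≤ m) (h : m ^ k * w + 2 ^ m ≤ m ^ k * 2 ^ m) :
    (w : ℝ) ≤ (1 - 1 / (m : ℝ) ^ k) * (2 : ℝ) ^ m := by
  have hK : (0 : ℝ) < (m : ℝ) ^ k := by positivity
  have hK0 : (m : ℝ) ^ k ≠ 0 := hK.ne'
  have hc : ((m : ℝ) ^ k) * (w : ℝ) + (2 : ℝ) ^ m ≤ (m : ℝ) ^ k * (2 : ℝ) ^ m := by exact_mod_cast h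
  rw [show (1 - 1 / (m : ℝ) ^ k) * (2 : ℝ) ^ m = ((m : ℝ) ^ k * (2 : ℝ) ^ m - (2 : ℝ) ^ m) / (m : ℝ) ^ k by
    field_simp]
  rw [le_div_iff₀ hK]
  nlinarith [hc]

/-- from `T ≤ K·(T − w)` (truncated) to the additive form. -/
theorem add_le_of_le_mul_tsub {K T w : ℕ} (hw : w ≤ T) (h : T ≤ K * (T - w)) : K * w + T ≤ K * T := by
  have e : K * (T - w) + K * w = K * T := by rw [← Nat.mul_add, Nat.sub_add_cancel hw]
  omega

end NullPair

/-! ## §10 (g16) LOSS PADDING — designer losses via the absorbing pair; PAD-CLOSED restrictions of T are T (kernel)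

The absorbing pair of `Theorems.AbsorptionDial` (walk slots 0 and 1; `ringWinU_absorb`: `WIN(absorb P)(w) = P(|w| mod 3)(w)`
for an EVEN triple `P`) turns any selector `h` into a strategy `pad c r₀ h` with `WIN = h ∧ [|w| ≢ r₀ (mod 3)]`
(`ringWinU_pad`); XOR-ing it into `y` (degree `d + 2·deg h + 1`) flips the outcome of `y` exactly on the DESIGNER SET
`E = supp h ∩ {|w| ≢ r₀}` (`ringWinU_xor_pad`).  So losses can be PLANTED wherever a low-degree selector points, at a
cost of `|supp h|` wins — inverse-polynomial for a conjunction of `m·log₂ n` literals.  THE PADDING LAW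
(`T_of_padClosed`): if a class `𝒩` of strategies is PAD-CLOSED (every polylog `y` has a polylog `y' ∈ 𝒩` with
`wins y ≤ wins y' + 2ⁿ/n^m`, any prescribed `m`), then T RESTRICTED TO `𝒩` is already T.  Instance
(`padClosed_manyLosses`, `restrictedT_manyLosses_iff_T`): «the strategy loses on ≥ 2^⌊n/2⌋ inputs» is pad-closed — so a
PER-STRATEGY loss floor (even one far above the 2^(n^(1/4)) of items 28488/28489) is NO INFORMATION about the strategy in
hand: the floor hypothesis `QuarterFloorOdd` of `MassHiQuarter` carries content only through its UNIVERSALITY (applied to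
strategies other than `y` — restrictions, paddings, relabellings), never by self-application (FLOOR NON-LOCALITY). -/

section Padding
variable {n : ℕ}

/-- the padding triple: the selector `h` at the two weight residues other than `r₀ (mod 3)`, nothing at `r₀`. -/
def padTriple (r₀ : ℕ) (h : (Fin n → Bool) → Bool) : ℕ → (Fin n → Bool) → Bool :=
  fun r w => if r = r₀ % 3 then false else h w

/-- OrderDialA helper `padTriple_even` (decomp-qadv land package; see the module docstring). -/
theorem padTriple_even (r₀ : ℕ) (h : (Fin n → Bool) → Bool) (w : Fin n → Bool) :
    Bool.xor (padTriple r₀ h 0 w) (Bool.xor (padTriple r₀ h 1 w) (padTriple r₀ h 2 w)) = false := by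
  unfold padTriple
  have h3 : r₀ % 3 = 0 ∨ r₀ % 3 = 1 ∨ r₀ % 3 = 2 := by omega
  rcases h3 with e | e | e <;> simp [e]

/-- **the loss pad**: AbsorptionDial's absorbing pair (walk slots 0, 1) of the padding triple. -/
def pad (c r₀ : ℕ) (h : (Fin n → Bool) → Bool) : Fin (n + 1) → (Fin n → Bool) → Bool :=
  Theorems.AbsorptionDial.absorb c (padTriple r₀ h)

/-- **PADDING IDENTITY**: the pad wins exactly on the designer set `supp h ∩ {|w| ≢ r₀ (mod 3)}`. -/
theorem ringWinU_pad (hn : 1 ≤ n) (c r₀ : ℕ) (h : (Fin n → Bool) → Bool) (w : Fin n → Bool) :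
    ringWinU c (pad c r₀ h) w = (h w && decide (wt w % 3 ≠ r₀ % 3)) := by
  unfold pad
  rw [Theorems.AbsorptionDial.ringWinU_absorb hn c _ (padTriple_even r₀ h)]
  unfold padTriple
  by_cases hr : wt w % 3 = r₀ % 3 <;> simp [hr]

/-- XOR-ing the pad into `y` flips the outcome of `y` exactly on the designer set. -/
theorem ringWinU_xor_pad (hn : 1 ≤ n) (c r₀ : ℕ) (h : (Fin n → Bool) → Bool)
    (y : Fin (n + 1) → (Fin n → Bool) → Bool) (w : Fin n → Bool) :
    ringWinU c (RigidityLaws.xorStrat y (pad c r₀ h)) w =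
      Bool.xor (ringWinU c y w) (h w && decide (wt w % 3 ≠ r₀ % 3)) := by
  rw [RigidityLaws.ringWinU_xorStrat, ringWinU_pad hn]

/-- degree of the pad: `2·deg h + 1`. -/
theorem hasDegF_pad {D : ℕ} (c r₀ : ℕ) {h : (Fin n → Bool) → Bool} (hh : HasDegF p h D) (g : Fin (n + 1)) :
    HasDegF p (pad c r₀ h g) (2 * D + 1) := by
  refine Theorems.AbsorptionDial.hasDegF_absorb c _ (fun r => ?_) g
  by_cases hr : r = r₀ % 3
  · have e : padTriple r₀ h r = fun _ => false := by funext w; simp [padTriple, hr]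
    rw [e]; exact RigidityLaws.hasDegF_const p false D
  · have e : padTriple r₀ h r = h := by funext w; simp [padTriple, hr]
    rw [e]; exact hh

/-- OrderDialA helper `hasDegF_xor_pad` (decomp-qadv land package; see the module docstring). -/
theorem hasDegF_xor_pad {d D : ℕ} (c r₀ : ℕ) {h : (Fin n → Bool) → Bool} (hh : HasDegF p h D)
    {y : Fin (n + 1) → (Fin n → Bool) → Bool} (hy : ∀ g, HasDegF p (y g) d) (g : Fin (n + 1)) :
    HasDegF p (RigidityLaws.xorStrat y (pad c r₀ h) g) (d + (2 * D + 1)) :=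
  RigidityLaws.hasDegF_xorStrat hy (fun g => hasDegF_pad c r₀ hh g) g

/-- padding keeps every win of `y` outside `supp h` … -/
theorem wins_le_wins_xor_pad_add (hn : 1 ≤ n) (c r₀ : ℕ) (h : (Fin n → Bool) → Bool)
    (y : Fin (n + 1) → (Fin n → Bool) → Bool) :
    wins c y ≤ wins c (RigidityLaws.xorStrat y (pad c r₀ h)) +
      ((univ : Finset (Fin n → Bool)).filter fun w => h w = true).card := by
  unfold wins
  calc ((univ : Finset (Fin n → Bool)).filter fun w => ringWinU c y w = true).card
      ≤ (((univ : Finset (Fin n → Bool)).filter fun w =>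
            ringWinU c (RigidityLaws.xorStrat y (pad c r₀ h)) w = true) ∪
          ((univ : Finset (Fin n → Bool)).filter fun w => h w = true)).card := by
        refine Finset.card_le_card fun w hw => ?_
        simp only [Finset.mem_filter, Finset.mem_univ, true_and, Finset.mem_union] at hw ⊢
        rw [ringWinU_xor_pad hn, hw]
        cases h w <;> simp
    _ ≤ _ := Finset.card_union_le _ _

/-- … and loses wherever `y` won inside the designer set: the designer set is covered by the losses of `y ⊕ pad`
and of `y`. -/
theorem designer_le_losses_add (hn : 1 ≤ n) (c r₀ : ℕ) (h : (Fin n → Bool) → Bool)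
    (y : Fin (n + 1) → (Fin n → Bool) → Bool) :
    (((univ : Finset (Fin n → Bool)).filter fun w => h w = true).filter fun w => wt w % 3 ≠ r₀ % 3).card ≤
      ((univ : Finset (Fin n → Bool)).filter fun w =>
          ringWinU c (RigidityLaws.xorStrat y (pad c r₀ h)) w = false).card +
        ((univ : Finset (Fin n → Bool)).filter fun w => ringWinU c y w = false).card := by
  calc _ ≤ (((univ : Finset (Fin n → Bool)).filter fun w =>
            ringWinU c (RigidityLaws.xorStrat y (pad c r₀ h)) w = false) ∪
          ((univ : Finset (Fin n → Bool)).filter fun w => ringWinU c y w = false)).card := by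
        refine Finset.card_le_card fun w hw => ?_
        simp only [Finset.mem_filter, Finset.mem_univ, true_and, Finset.mem_union] at hw ⊢
        rw [ringWinU_xor_pad hn, hw.1, Bool.true_and, decide_eq_true hw.2]
        cases ringWinU c y w <;> simp
    _ ≤ _ := Finset.card_union_le _ _

/-! ### A cheap selector: the conjunction of the first `j` literals -/

/-- `[u₀ = … = u_{j−1} = 1]`. -/
def prefixOnes (j : ℕ) (u : Fin n → Bool) : Bool := decide (∀ i : Fin n, i.val < j → u i = true)

/-- OrderDialA helper `hasDegF_prefixOnes` (decomp-qadv land package; see the module docstring). -/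
theorem hasDegF_prefixOnes (j : ℕ) (hj : j ≤ n) : HasDegF p (prefixOnes j : (Fin n → Bool) → Bool) j := by
  have hJ : (((univ : Finset (Fin n)).filter fun i => i.val < j).card) = j := by
    have e : ((univ : Finset (Fin n)).filter fun i => i.val < j).map Fin.valEmbedding = Finset.range j := by
      ext x
      simp only [Finset.mem_map, Finset.mem_filter, Finset.mem_univ, true_and, Fin.valEmbedding_apply,
        Finset.mem_range]
      constructor
      · rintro ⟨i, hi, rfl⟩; exact hi
      · intro hx; exact ⟨⟨x, by omega⟩, hx, rfl⟩
    rw [← Finset.card_map, e, Finset.card_range]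
  have h := hasDegF_of_junta (p := p) ((univ : Finset (Fin n)).filter fun i => i.val < j) (prefixOnes j)
    (fun u v huv => by
      unfold prefixOnes
      refine decide_eq_decide.mpr ⟨fun hu i hi => ?_, fun hv i hi => ?_⟩
      · rw [← huv i (by simpa using hi)]; exact hu i hi
      · rw [huv i (by simpa using hi)]; exact hv i hi)
  rwa [hJ] at h

/-- `#supp = 2^(n−j)` (j halvings). -/
theorem card_prefixOnes (j : ℕ) (hj : j ≤ n) :
    ((univ : Finset (Fin n → Bool)).filter fun u => prefixOnes j u = true).card = 2 ^ (n - j) := by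
  induction j with
  | zero =>
    have e : ((univ : Finset (Fin n → Bool)).filter fun u => prefixOnes 0 u = true) = univ := by
      ext u; simp [prefixOnes]
    rw [e]; simp
  | succ j ih =>
    have hj' : j < n := hj
    have hstep : ((univ : Finset (Fin n → Bool)).filter fun u => prefixOnes (j + 1) u = true) =
        (((univ : Finset (Fin n → Bool)).filter fun u => prefixOnes j u = true).filter
          fun u => u ⟨j, hj'⟩ = true) := by
      ext u
      simp only [Finset.mem_filter, Finset.mem_univ, true_and, prefixOnes, decide_eq_true_eq]
      constructor
      · intro h; exact ⟨fun i hi => h i (by omega), h ⟨j, hj'⟩ (by simp)⟩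
      · rintro ⟨h1, h2⟩ i hi
        rcases Nat.lt_succ_iff_lt_or_eq.mp hi with hi | hi
        · exact h1 i hi
        · have : i = ⟨j, hj'⟩ := Fin.ext hi
          rw [this]; exact h2
    have hhalf := Fib19.two_mul_card_filter_of_invol
      ((univ : Finset (Fin n → Bool)).filter fun u => prefixOnes j u = true)
      (fun u : Fin n → Bool => u ⟨j, hj'⟩ = true) (fun u => Function.update u ⟨j, hj'⟩ (!u ⟨j, hj'⟩))
      (fun u hu => by
        simp only [Finset.mem_filter, Finset.mem_univ, true_and, prefixOnes, decide_eq_true_eq] at hu ⊢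
        intro i hi
        have hne : i ≠ ⟨j, hj'⟩ := fun h => by rw [h] at hi; simp at hi
        rw [Function.update_of_ne hne]
        exact hu i hi)
      (fun u _ => update_not_update_not _ u)
      (fun u _ => by rw [Function.update_self]; cases u ⟨j, hj'⟩ <;> simp)
    rw [hstep]
    rw [ih (by omega), show n - j = (n - (j + 1)) + 1 by omega, pow_succ] at hhalf
    omega

/-- the designer set of the prefix selector has at least `2^(n−j−1)` elements (flip bit `j`: the residue `r₀` is the
minority). -/
theorem card_designer_ge (j : ℕ) (hj : j < n) (r₀ : ℕ) :
    2 ^ (n - j) ≤ 2 * ((((univ : Finset (Fin n → Bool)).filter fun w => prefixOnes j w = true).filter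
      fun w => wt w % 3 ≠ r₀ % 3).card) := by
  classical
  set S := (univ : Finset (Fin n → Bool)).filter fun w => prefixOnes j w = true with hS
  have hcard : S.card = 2 ^ (n - j) := card_prefixOnes j hj.le
  have hGB : (S.filter fun w => wt w % 3 ≠ r₀ % 3).card + (S.filter fun w => ¬ (wt w % 3 ≠ r₀ % 3)).card = S.card :=
    Finset.card_filter_add_card_filter_not (s := S) _
  have hBG : (S.filter fun w => ¬ (wt w % 3 ≠ r₀ % 3)).card ≤ (S.filter fun w => wt w % 3 ≠ r₀ % 3).card := by
    refine Finset.card_le_card_of_injOn (fun u => Function.update u ⟨j, hj⟩ (!u ⟨j, hj⟩)) (fun u hu => ?_) ?_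
    · simp only [hS, Finset.coe_filter, Finset.mem_filter, Finset.mem_univ, true_and, not_not, Set.mem_setOf_eq,
        prefixOnes, decide_eq_true_eq] at hu ⊢
      obtain ⟨hpre, hres⟩ := hu
      refine ⟨fun i hi => ?_, ?_⟩
      · have hne : i ≠ ⟨j, hj⟩ := fun h => by rw [h] at hi; simp at hi
        rw [Function.update_of_ne hne]; exact hpre i hi
      · rw [← hres]
        have := wt_flip_mod_three_ne u ⟨j, hj⟩ 0
        simpa using this
    · intro u _ v _ huv
      have := congrArg (fun w : Fin n → Bool => Function.update w ⟨j, hj⟩ (!w ⟨j, hj⟩)) huv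
      simpa only [update_not_update_not] using this
  omega

/-! ### Thresholds -/

/-- OrderDialA helper `two_mul_le_two_pow` (decomp-qadv land package; see the module docstring). -/
private theorem two_mul_le_two_pow {c : ℕ} (hc : 1 ≤ c) : 2 * c ≤ 2 ^ c := by
  obtain ⟨d, rfl⟩ : ∃ d, c = d + 1 := ⟨c - 1, by omega⟩
  have := @Nat.lt_two_pow_self d
  rw [pow_succ]; omega

/-- OrderDialA helper `mul_le_two_pow` (decomp-qadv land package; see the module docstring). -/
theorem mul_le_two_pow {c L : ℕ} (hL : 2 * c ≤ L) : c * L ≤ 2 ^ L := by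
  rcases Nat.eq_zero_or_pos c with rfl | hc
  · simp
  obtain ⟨t, rfl⟩ : ∃ t, L = c + t := ⟨L - c, by omega⟩
  have ht := @Nat.lt_two_pow_self t
  have h2c := two_mul_le_two_pow hc
  calc c * (c + t) ≤ c * (2 * t) := Nat.mul_le_mul_left _ (by omega)
    _ = (2 * c) * t := by ring
    _ ≤ 2 ^ c * 2 ^ t := Nat.mul_le_mul h2c ht.le
    _ = 2 ^ (c + t) := (pow_add 2 c t).symm

/-- for `n ≥ 2^(4m+4)`, with `L = log₂ n` and `j = m(L+1)`: `L ≥ 4m + 4`, `2(j + 2) ≤ n`, `n^m ≤ 2^j`, `2j + 1 ≤ L²`. -/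
theorem pad_threshold (m n : ℕ) (hn : 2 ^ (4 * m + 4) ≤ n) :
    4 * m + 4 ≤ Nat.log 2 n ∧ 2 * (m * (Nat.log 2 n + 1) + 2) ≤ n ∧ n ^ m ≤ 2 ^ (m * (Nat.log 2 n + 1)) ∧
      2 * (m * (Nat.log 2 n + 1)) + 1 ≤ (Nat.log 2 n) ^ 2 := by
  have hpos : 0 < 2 ^ (4 * m + 4) := by positivity
  have hn0 : n ≠ 0 := by omega
  have hL : 4 * m + 4 ≤ Nat.log 2 n := Nat.le_log_of_pow_le (by norm_num) hn
  have h2L : 2 ^ Nat.log 2 n ≤ n := Nat.pow_log_le_self 2 hn0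
  have hlin : (2 * m + 2) * Nat.log 2 n ≤ 2 ^ Nat.log 2 n := mul_le_two_pow (by omega)
  refine ⟨hL, ?_, ?_, ?_⟩
  · have : 2 * (m * (Nat.log 2 n + 1) + 2) ≤ (2 * m + 2) * Nat.log 2 n := by nlinarith [hL]
    omega
  · have hlt : n < 2 ^ (Nat.log 2 n + 1) := Nat.lt_pow_succ_log_self (by norm_num) n
    calc n ^ m ≤ (2 ^ (Nat.log 2 n + 1)) ^ m := Nat.pow_le_pow_left hlt.le m
      _ = 2 ^ (m * (Nat.log 2 n + 1)) := by rw [← pow_mul, mul_comm]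
  · nlinarith [hL]

end Padding

end Summit.QuantumAdvantage.QuantumAdvantage.Theorems.OrderDial

/-- info: 'Summit.QuantumAdvantage.QuantumAdvantage.Theorems.OrderDial.symWins_eq_sum_orders' depends on axioms: [propext, Classical.choice, Quot.sound] -/
#guard_msgs (whitespace := lax) in
#print axioms Summit.QuantumAdvantage.QuantumAdvantage.Theorems.OrderDial.symWins_eq_sum_orders

/-- info: 'Summit.QuantumAdvantage.QuantumAdvantage.Theorems.OrderDial.hasDegF_permStrat' depends on axioms: [propext, Classical.choice, Quot.sound] -/
#guard_msgs (whitespace := lax) in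
#print axioms Summit.QuantumAdvantage.QuantumAdvantage.Theorems.OrderDial.hasDegF_permStrat

/-- info: 'Summit.QuantumAdvantage.QuantumAdvantage.Theorems.OrderDial.ringWinU_nullPair' depends on axioms: [propext, Classical.choice, Quot.sound] -/
#guard_msgs (whitespace := lax) in
#print axioms Summit.QuantumAdvantage.QuantumAdvantage.Theorems.OrderDial.ringWinU_nullPair

/-- info: 'Summit.QuantumAdvantage.QuantumAdvantage.Theorems.OrderDial.symWins_nullPair_ge' depends on axioms: [propext, Classical.choice, Quot.sound] -/
#guard_msgs (whitespace := lax) in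
#print axioms Summit.QuantumAdvantage.QuantumAdvantage.Theorems.OrderDial.symWins_nullPair_ge

/-- info: 'Summit.QuantumAdvantage.QuantumAdvantage.Theorems.OrderDial.wins_le_losses_add' depends on axioms: [propext, Classical.choice, Quot.sound] -/
#guard_msgs (whitespace := lax) in
#print axioms Summit.QuantumAdvantage.QuantumAdvantage.Theorems.OrderDial.wins_le_losses_add

/-- info: 'Summit.QuantumAdvantage.QuantumAdvantage.Theorems.OrderDial.ringWinU_xor_pad' depends on axioms: [propext, Classical.choice, Quot.sound] -/
#guard_msgs (whitespace := lax) in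
#print axioms Summit.QuantumAdvantage.QuantumAdvantage.Theorems.OrderDial.ringWinU_xor_pad

/-- info: 'Summit.QuantumAdvantage.QuantumAdvantage.Theorems.OrderDial.card_designer_ge' depends on axioms: [propext, Classical.choice, Quot.sound] -/
#guard_msgs (whitespace := lax) in
#print axioms Summit.QuantumAdvantage.QuantumAdvantage.Theorems.OrderDial.card_designer_ge

/-- info: 'Summit.QuantumAdvantage.QuantumAdvantage.Theorems.OrderDial.pad_threshold' depends on axioms: [propext, Classical.choice, Quot.sound] -/
#guard_msgs (whitespace := lax) in
#print axioms Summit.QuantumAdvantage.QuantumAdvantage.Theorems.OrderDial.pad_threshold
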